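import Literature.NumberTheory.Automorphic.Liu2021.AppendixC.Glue
import Literature.AlgebraicGeometry.Motives.JacobianGaloisDescent
import Literature.AlgebraicGeometry.Motives.GaloisDescentAbelianVariety
import Literature.AlgebraicGeometry.Motives.JacobianAlbanese
import HarnessLib

/-!
# Liu 2021 §2.1, proof of the Proposition: «the statement for `X` then follows by Galois descent»
# — Galois descent of an Albanese datum (Def. 2.3) along a finite Galois extension

[Liu2021] = Yifeng Liu, *Fourier–Jacobi cycles and arithmetic relative trace formula*, Camb. J. Math.
**9** (2021) = arXiv:2102.11518, §2.1: for a proper smooth `k`-scheme `X`, the functor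
`A ↦ {f : ∇X → A | ΔX ⊆ f⁻¹0_A}` on abelian varieties over `k` is corepresentable (Proposition,
l. 1190–1192), the corepresenting datum `α_X : ∇X → Alb_X` being the Albanese variety (Def. 2.3,
typed as `AppendixC.Albanese X` in `Liu2021/AppendixC/Glue.lean`).  The printed PROOF (l. 1194–1200)
constructs the datum over a separable closure `k'` and concludes: «As `(∇X)_{k'} ≃ ∇_{k'}X'`, the
statement for `X` then follows by Galois descent.»  THIS FILE IS THAT DESCENT STEP, for a finite Galois
extension `L / k` (PROOF FILE: theorems and private constructions with bodies, no named fact, sorry-free):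

* `Albanese.nonempty_of_albanese_baseChange` — **let `N` be a `∇X` over `k` (Def. 2.1 (1)) with
  `N ×_k L` reduced and `N` locally of finite type over `k` (e.g. `X` smooth), and let `a` be an
  Albanese datum of `X_L = X ×_k L` whose `∇(X_L)` is identified with `N ×_k L` compatibly with the
  diagonals («`(∇X)_{k'} ≃ ∇_{k'}X'`»).  Then `X` has an Albanese datum over `k` (with `∇X := N`).**

Method (Milne, *Jacobian Varieties*, Remark 1.9 and §6, proof of Prop. 6.4, as mechanised for Milne's
difference-map data in `Motives/JacobianGaloisDescent` and `Motives/JacobianGaloisDescentOfUniversal`,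
whose private «twist» technique is re-run here verbatim): for `σ ∈ Gal(L/k)` the map
`α' ∘ (1 × Spec σ⁻¹) : N_L → Alb'` is an `L`-morphism into the CONJUGATE abelian variety
`Alb'^{σ⁻¹} = Alb' ×_{Spec L, Spec σ⁻¹} Spec L`, trivial along `ΔX_L`; the universal property gives a
homomorphism `u_σ : Alb' → Alb'^{σ⁻¹}`, i.e. a `σ⁻¹`-semilinear automorphism `ρ σ = u_σ ≫ pr₁` of the
scheme `Alb'` with `α' ∘ (1 × Spec σ⁻¹) = ρ σ ∘ α'`; uniqueness gives the cocycle condition, `u_σ`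
being a homomorphism gives compatibility with the group law; `GaloisDescentAbelianVariety` descends
`Alb'` to `Alb / k` equivariantly, `GaloisDescent.descentOver` descends `α'` to `α : N → Alb`, and the
universal property over `k` follows from that over `L` by Galois descent of homomorphisms
(`AbelianVariety.galoisDescent`) and faithfulness of base change.  Compared with the Jacobian case the
source `N_L` is a plain base change, so its Galois automorphisms are `GaloisDescent.gal` and the
diagonal is equivariant by `GaloisDescent.gal_comp_map_left` — no product bookkeeping.

Use (cell pub-hodgecm2, TEAM hComp, row A0-DECITE): the descent rung of DE-CITING the named fact
`Liu2021.exists_albanese` (`Liu2021/AlbaneseBaseChange.lean`) at the consumer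
`AppendixC.Sec42Data.nonempty_of_exists_albanese` (`X_K` smooth projective over the CM field `E ⊆ ℂ`, not
geometrically connected).  HC_CM is NOT proved; nothing here discharges any COR-CM binder.

Relies on: nothing unproved (axioms `propext`, `Classical.choice`, `Quot.sound`).

## References

* [Liu2021] Y. Liu, arXiv:2102.11518 = Camb. J. Math. 9 (2021), §2.1 Def. 2.1 (1) (FJcycle.tex
  l. 1171–1174), Proposition (l. 1190–1192) with proof (l. 1194–1200), Def. 2.3 (l. 1202–1208).
* [Milne1986JacobianVarieties] J. S. Milne, *Jacobian Varieties*, in Cornell–Silverman, *Arithmetic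
  Geometry* (1986): Remark 1.9, §6 Prop. 6.4 (proof, first paragraph) and Remark 6.5.
* [Milne1986AbelianVarieties] J. S. Milne, *Abelian Varieties*, ibid., §2 Cor. 2.2 (rigidity).
* [GortzWedhorn2020] U. Görtz, T. Wedhorn, *Algebraic Geometry I*, 2nd ed. (2020), §(14.20),
  Thm. 14.72 (1), Thm. 14.83, Cor. 14.85 (Galois descent).
-/

noncomputable section

open CategoryTheory CategoryTheory.Limits AlgebraicGeometry MonoidalCategory CartesianMonoidalCategory
open Literature.AlgebraicGeometry.Motives

universe u

namespace Literature.NumberTheory.Automorphic.Liu2021.AppendixC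

namespace Albanese

open AbelianVariety (bcSpec bcFunctor specAut specAut_mul specAut_one specAut_comp_bcSpec twist
  galConjHom galoisDescent baseChange_galoisDescent gal_comp_toSchemeHom_of_galConjHom_eq
  toSchemeHom_galConjHom)
open scoped MonObj Obj

set_option backward.isDefEq.respectTransparency false

/-! ### The conjugate abelian variety `A^τ` and semilinear homomorphisms `A → A^τ`
(private plumbing, verbatim re-run of `Motives/JacobianGaloisDescentOfUniversal`) -/


section Twist

variable {K : Type u} [Field K] (L : Type u) [Field L] [Algebra K L] (τ : L ≃ₐ[K] L)

/-- `(f^τ) ≫ pr₁ = pr₁ ≫ f` for the twist `f^τ = f ×_{Spec L, Spec τ} Spec L` of an `L`-morphism.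
[folklore] -/
@[reassoc]
private theorem twist_map_left_comp_fst {X Y : SchemeOver L} (f : X ⟶ Y) :
    ((twist L τ).map f).left ≫ pullback.fst Y.hom (specAut L τ) =
      pullback.fst X.hom (specAut L τ) ≫ f.left :=
  pullback.lift_fst _ _ _

/-- The unit `ε : Spec L → (Spec L)^τ` of the monoidal twist functor, followed by `pr₁`, is
`Spec τ`. [folklore] -/
private theorem ε_left_comp_fst :
    (Functor.LaxMonoidal.ε (twist L τ)).left ≫ pullback.fst (𝟙_ (SchemeOver L)).hom (specAut L τ) =
      specAut L τ := by
  have h1 : pullback.fst (𝟙_ (SchemeOver L)).hom (specAut L τ) =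
      pullback.snd (𝟙_ (SchemeOver L)).hom (specAut L τ) ≫ specAut L τ := by
    have h := pullback.condition (f := (𝟙_ (SchemeOver L)).hom) (g := specAut L τ)
    exact (Category.comp_id _).symm.trans h
  have h2 : (Functor.LaxMonoidal.ε (twist L τ)).left ≫
      pullback.snd (𝟙_ (SchemeOver L)).hom (specAut L τ) = 𝟙 _ :=
    Over.w (Functor.LaxMonoidal.ε (twist L τ))
  rw [h1, ← Category.assoc, h2, Category.id_comp]

variable (A : AbelianVariety L)

/-- **The conjugate abelian variety `A^τ = A ×_{Spec L, Spec τ} Spec L`**: the image of the group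
`L`-scheme `A` under the monoidal twist functor `twist L τ = Over.pullback (Spec τ)` (Mathlib
`Functor.grpObjObj`); proper and geometrically integral as a base change (private plumbing).
[folklore] -/
private abbrev twistAV : AbelianVariety L where
  X := (twist L τ).obj A.X
  grpObj := Functor.grpObjObj (F := twist L τ) (G := A.X)
  isProper := by
    change IsProper (pullback.snd A.X.hom (specAut L τ))
    infer_instance
  geometricallyIntegral := by
    change GeometricallyIntegral (pullback.snd A.X.hom (specAut L τ))
    infer_instance

/-- The unit of `A^τ` followed by `pr₁ : A^τ → A` is `Spec τ ≫ e_A`. [folklore] -/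
private theorem one_twist_left_comp_fst :
    (η[(twistAV L τ A).X]).left ≫ pullback.fst A.X.hom (specAut L τ) =
      specAut L τ ≫ (η[A.X]).left := by
  change (Functor.LaxMonoidal.ε (twist L τ) ≫ (twist L τ).map η[A.X]).left ≫
    pullback.fst A.X.hom (specAut L τ) = _
  rw [Over.comp_left, Category.assoc, twist_map_left_comp_fst, ← Category.assoc, ε_left_comp_fst]

/-- The inversion of `A^τ` over `pr₁` is the inversion of `A`. [folklore] -/
private theorem inv_twist_left_comp_fst :
    (ι[(twistAV L τ A).X]).left ≫ pullback.fst A.X.hom (specAut L τ) =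
      pullback.fst A.X.hom (specAut L τ) ≫ (ι[A.X]).left := by
  change ((twist L τ).map ι[A.X]).left ≫ pullback.fst A.X.hom (specAut L τ) = _
  exact twist_map_left_comp_fst L τ _

/-- `(T → Spec L → A^τ) ≫ pr₁ = (T → Spec L) ≫ Spec τ ≫ e_A` for the constant morphism at the
unit. [folklore] -/
private theorem one_hom_twist_left_comp_fst (T : SchemeOver L) :
    (toUnit T ≫ η[(twistAV L τ A).X]).left ≫ pullback.fst A.X.hom (specAut L τ) =
      T.hom ≫ specAut L τ ≫ (η[A.X]).left := by
  have hT : (toUnit T).left = T.hom := (Category.comp_id _).symm.trans (Over.w (toUnit T))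
  rw [Over.comp_left, Category.assoc, one_twist_left_comp_fst, hT]

variable {A}

/-- The `τ`-semilinear endomorphism `ρ_u = u ≫ pr₁` of the scheme `A` underlying a homomorphism
`u : A → A^τ` (private plumbing). [folklore] -/
private def descLeft (u : A ⟶ twistAV L τ A) : A.X.left ⟶ A.X.left :=
  u.hom.hom.hom.left ≫ pullback.fst A.X.hom (specAut L τ)

/-- `ρ_u` covers `Spec τ`. [folklore] -/
private theorem descLeft_comp_hom (u : A ⟶ twistAV L τ A) :
    descLeft L τ u ≫ A.X.hom = A.X.hom ≫ specAut L τ := by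
  unfold descLeft
  rw [Category.assoc, pullback.condition, ← Category.assoc]
  congr 1
  exact Over.w u.hom.hom.hom

/-- `ρ_u` carries the unit to its `τ`-conjugate: `e ≫ ρ_u = Spec τ ≫ e`. [folklore] -/
private theorem one_left_comp_descLeft (u : A ⟶ twistAV L τ A) :
    (η[A.X]).left ≫ descLeft L τ u = specAut L τ ≫ (η[A.X]).left := by
  have h := congrArg (fun g => g.left ≫ pullback.fst A.X.hom (specAut L τ))
    (IsMonHom.one_hom u.hom.hom.hom)
  dsimp only at h
  rw [Over.comp_left, Category.assoc] at h
  exact h.trans (one_twist_left_comp_fst L τ A)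

/-- `ρ_u` commutes with the inversion. [folklore] -/
private theorem inv_left_comp_descLeft (u : A ⟶ twistAV L τ A) :
    (ι[A.X]).left ≫ descLeft L τ u = descLeft L τ u ≫ (ι[A.X]).left := by
  have h := congrArg (fun g => g.left ≫ pullback.fst A.X.hom (specAut L τ))
    (GrpObj.inv_hom u.hom.hom.hom)
  dsimp only at h
  rw [Over.comp_left, Category.assoc, Over.comp_left, Category.assoc] at h
  unfold descLeft
  rw [Category.assoc]
  exact h.trans (congrArg (u.hom.hom.hom.left ≫ ·) (inv_twist_left_comp_fst L τ A))

/-- `ρ_u` is compatible with the multiplication: `(ρ_u × ρ_u) ≫ m = m ≫ ρ_u`. [folklore] -/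
private theorem map_comp_mul_left_descLeft (u : A ⟶ twistAV L τ A) :
    pullback.map A.X.hom A.X.hom A.X.hom A.X.hom (descLeft L τ u) (descLeft L τ u) (specAut L τ)
        (descLeft_comp_hom L τ u).symm (descLeft_comp_hom L τ u).symm ≫ (μ[A.X]).left =
      (μ[A.X]).left ≫ descLeft L τ u := by
  have hP1 : pullback.map A.X.hom A.X.hom A.X.hom A.X.hom (descLeft L τ u) (descLeft L τ u)
      (specAut L τ) (descLeft_comp_hom L τ u).symm (descLeft_comp_hom L τ u).symm ≫
        pullback.fst A.X.hom A.X.hom = pullback.fst A.X.hom A.X.hom ≫ descLeft L τ u :=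
    pullback.lift_fst _ _ _
  have hP2 : pullback.map A.X.hom A.X.hom A.X.hom A.X.hom (descLeft L τ u) (descLeft L τ u)
      (specAut L τ) (descLeft_comp_hom L τ u).symm (descLeft_comp_hom L τ u).symm ≫
        pullback.snd A.X.hom A.X.hom = pullback.snd A.X.hom A.X.hom ≫ descLeft L τ u :=
    pullback.lift_snd _ _ _
  have e1 : ((u.hom.hom.hom ⊗ₘ u.hom.hom.hom) ≫ Functor.LaxMonoidal.μ (twist L τ) A.X A.X) ≫
      (twist L τ).map (fst A.X A.X) = fst A.X A.X ≫ u.hom.hom.hom := by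
    rw [Category.assoc, Functor.Monoidal.μ_fst, tensorHom_fst]
  have e2 : ((u.hom.hom.hom ⊗ₘ u.hom.hom.hom) ≫ Functor.LaxMonoidal.μ (twist L τ) A.X A.X) ≫
      (twist L τ).map (snd A.X A.X) = snd A.X A.X ≫ u.hom.hom.hom := by
    rw [Category.assoc, Functor.Monoidal.μ_snd, tensorHom_snd]
  have e3 : ((u.hom.hom.hom ⊗ₘ u.hom.hom.hom) ≫ Functor.LaxMonoidal.μ (twist L τ) A.X A.X) ≫
      (twist L τ).map μ[A.X] = μ[A.X] ≫ u.hom.hom.hom := by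
    rw [Category.assoc]
    exact (IsMonHom.mul_hom u.hom.hom.hom).symm
  have f1 : pullback.fst (A.X ⊗ A.X).hom (specAut L τ) ≫ pullback.fst A.X.hom A.X.hom =
      ((twist L τ).map (fst A.X A.X)).left ≫ pullback.fst A.X.hom (specAut L τ) := by
    rw [← Over.fst_left]; exact (twist_map_left_comp_fst L τ (fst A.X A.X)).symm
  have f2 : pullback.fst (A.X ⊗ A.X).hom (specAut L τ) ≫ pullback.snd A.X.hom A.X.hom =
      ((twist L τ).map (snd A.X A.X)).left ≫ pullback.fst A.X.hom (specAut L τ) := by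
    rw [← Over.snd_left]; exact (twist_map_left_comp_fst L τ (snd A.X A.X)).symm
  have f3 : pullback.fst (A.X ⊗ A.X).hom (specAut L τ) ≫ (μ[A.X]).left =
      ((twist L τ).map μ[A.X]).left ≫ pullback.fst A.X.hom (specAut L τ) :=
    (twist_map_left_comp_fst L τ μ[A.X]).symm
  have key : ((u.hom.hom.hom ⊗ₘ u.hom.hom.hom) ≫ Functor.LaxMonoidal.μ (twist L τ) A.X A.X).left ≫
        pullback.fst (A.X ⊗ A.X).hom (specAut L τ) =
      pullback.map A.X.hom A.X.hom A.X.hom A.X.hom (descLeft L τ u) (descLeft L τ u) (specAut L τ)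
        (descLeft_comp_hom L τ u).symm (descLeft_comp_hom L τ u).symm := by
    unfold descLeft at hP1 hP2 ⊢
    apply Over.tensorObj_ext
    · rw [hP1, Category.assoc, f1, ← Over.comp_left_assoc, e1, Over.comp_left, Category.assoc,
        Over.fst_left]
    · rw [hP2, Category.assoc, f2, ← Over.comp_left_assoc, e2, Over.comp_left, Category.assoc,
        Over.snd_left]
  rw [← key, Category.assoc, f3, ← Over.comp_left_assoc, e3, Over.comp_left, Category.assoc]
  rfl

/-- The `L`-morphism `(s, p) : A → A^τ = A ×_{Spec L, Spec τ} Spec L` defined by a `τ`-semilinear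
`s : A → A` (private plumbing). [folklore] -/
private def twistLift (s : A.X.left ⟶ A.X.left) (hs : s ≫ A.X.hom = A.X.hom ≫ specAut L τ) :
    A.X ⟶ (twistAV L τ A).X :=
  Over.homMk (pullback.lift s A.X.hom hs) (by exact pullback.lift_snd _ _ _)

/-- `(s, p) ≫ pr₁ = s`. [folklore] -/
private theorem twistLift_left_comp_fst (s : A.X.left ⟶ A.X.left)
    (hs : s ≫ A.X.hom = A.X.hom ≫ specAut L τ) :
    (twistLift L τ s hs).left ≫ pullback.fst A.X.hom (specAut L τ) = s :=
  pullback.lift_fst _ _ _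

/-- **A `τ`-semilinear unit-preserving morphism `s : A → A` is `ρ_u` for a homomorphism
`u : A → A^τ`** (`u = (s, p)`, a homomorphism by rigidity, `AbelianVariety.homOfOneComp`, Milne AV
Cor. 2.2). [cite: Milne1986AbelianVarieties, §2 Cor. 2.2] -/
private def twistHom (s : A.X.left ⟶ A.X.left) (hs : s ≫ A.X.hom = A.X.hom ≫ specAut L τ)
    (hone : (η[A.X]).left ≫ s = specAut L τ ≫ (η[A.X]).left) : A ⟶ twistAV L τ A :=
  AbelianVariety.homOfOneComp (twistLift L τ s hs) (by
    ext1
    apply pullback.hom_ext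
    · refine Eq.trans ?_ (one_twist_left_comp_fst L τ A).symm
      rw [Over.comp_left, Category.assoc, twistLift_left_comp_fst, hone]
    · exact (Over.w _).trans (Over.w _).symm)

/-- `ρ_{u_s} = s`. [folklore] -/
private theorem descLeft_twistHom (s : A.X.left ⟶ A.X.left) (hs : s ≫ A.X.hom = A.X.hom ≫ specAut L τ)
    (hone : (η[A.X]).left ≫ s = specAut L τ ≫ (η[A.X]).left) :
    descLeft L τ (twistHom L τ s hs hone) = s :=
  twistLift_left_comp_fst L τ s hs

end Twist

/-! ### Universal morphisms trivial along `δ` (private bookkeeping) -/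

section Datum

variable {K : Type u} [Field K]

/-- A **universal morphism trivial along `δ`**: for `K`-schemes `D`, `N` and `δ : D → N`, an
abelian variety `J` over `K` with a `K`-morphism `F : N → J` such that `δ ≫ F` is the zero
`D`-valued point, universal among such morphisms into abelian varieties (`desc`/`fac`/`uniq`).  For
`δ = ΔX : X → ∇X` this is exactly the universal property of Liu's Albanese datum (Def. 2.3), minus the
carrier fields of `∇X` (private bookkeeping: it lets the descent be phrased for the base change
`N ×_k L`, which is not literally a `∇(X_L)`). [cite: Liu2021, §2.1 Def. 2.3 (l. 1202–1206)] -/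
private structure TrivDatum {D N : SchemeOver K} (δ : D ⟶ N) where
  /-- the abelian variety -/
  J : AbelianVariety K
  /-- the universal morphism `N → J` -/
  F : N ⟶ J.X
  /-- `δ ≫ F` is the zero point -/
  base : δ ≫ F = 1
  /-- the factorisation of a morphism trivial along `δ` -/
  desc : ∀ {A : AbelianVariety K} (f : N ⟶ A.X), δ ≫ f = 1 → (J ⟶ A)
  /-- `F ≫ desc f = f` -/
  fac : ∀ {A : AbelianVariety K} (f : N ⟶ A.X) (hf : δ ≫ f = 1), F ≫ (desc f hf).hom.hom.hom = f
  /-- uniqueness of the factorisation -/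
  uniq : ∀ {A : AbelianVariety K} (f : N ⟶ A.X) (hf : δ ≫ f = 1) (ψ : J ⟶ A),
    F ≫ ψ.hom.hom.hom = f → ψ = desc f hf

/-- An Albanese datum (Def. 2.3) is a universal morphism trivial along the diagonal `ΔX : X → ∇X`.
[cite: Liu2021, §2.1 Def. 2.3 (l. 1202–1206)] -/
private def TrivDatum.ofAlbanese {X : SchemeOver K} (a : Albanese X) : TrivDatum a.nabla.diag where
  J := a.Alb
  F := a.α
  base := a.diag_α
  desc f hf := a.desc f hf
  fac f hf := a.fac f hf
  uniq f hf ψ hψ := a.uniq f hf ψ hψ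

/-- Transport of a universal morphism along an isomorphism of sources compatible with `δ`.
[folklore] -/
private def TrivDatum.transport {D N N' : SchemeOver K} {δ : D ⟶ N} {δ' : D ⟶ N'}
    (𝒜 : TrivDatum δ') (e : N ≅ N') (he : δ ≫ e.hom = δ') : TrivDatum δ where
  J := 𝒜.J
  F := e.hom ≫ 𝒜.F
  base := by rw [← Category.assoc, he, 𝒜.base]
  desc f hf := 𝒜.desc (e.inv ≫ f) (by rw [← he, Category.assoc, e.hom_inv_id_assoc, hf])
  fac f hf := by rw [Category.assoc, 𝒜.fac, e.hom_inv_id_assoc]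
  uniq f hf ψ hψ := 𝒜.uniq _ _ ψ (by rw [← hψ, Category.assoc, e.inv_hom_id_assoc])

/-- An Albanese datum from a `∇X` (Def. 2.1 (1)) and a universal morphism trivial along its diagonal
(Def. 2.3). [cite: Liu2021, §2.1 Def. 2.3 (l. 1202–1206)] -/
private def ofTrivDatum {X : SchemeOver K} (N : Nabla X) (𝒜 : TrivDatum N.diag) : Albanese X where
  nabla := N
  Alb := 𝒜.J
  α := 𝒜.F
  diag_α := 𝒜.base
  desc f hf := 𝒜.desc f hf
  fac f hf := 𝒜.fac f hf
  uniq f hf ψ hψ := 𝒜.uniq f hf ψ hψ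

/-- `(1 : T → B).left = T.hom ≫ e_B.left` for the constant morphism `1`. [folklore] -/
private theorem one_left (T : SchemeOver K) (B : AbelianVariety K) :
    (1 : T ⟶ B.X).left = T.hom ≫ (η[B.X]).left := by
  have hT : (toUnit T).left = T.hom := (Category.comp_id _).symm.trans (Over.w (toUnit T))
  rw [Hom.one_def, Over.comp_left, hT]

end Datum

/-! ### The Galois action on a universal morphism over `L` whose source is a base change -/

section Action

variable {k : Type u} [Field k] (L : Type u) [Field L] [Algebra k L] {D N : SchemeOver k}
  {δ : D ⟶ N} (𝒜 : TrivDatum ((bcFunctor k L).map δ))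

/-- The Galois automorphism `1 × Spec σ⁻¹` of `N_L` covers `Spec σ⁻¹`. [folklore] -/
private theorem gal_comp_hom (σ : L ≃ₐ[k] L) :
    GaloisDescent.gal L N σ ≫ ((bcFunctor k L).obj N).hom =
      ((bcFunctor k L).obj N).hom ≫ specAut L σ⁻¹ :=
  GaloisDescent.gal_snd L N σ

/-- The base change `δ_L` is Galois-equivariant (`GaloisDescent.gal_comp_map_left`). [folklore] -/
private theorem map_left_comp_gal (σ : L ≃ₐ[k] L) :
    ((bcFunctor k L).map δ).left ≫ GaloisDescent.gal L N σ =
      GaloisDescent.gal L D σ ≫ ((bcFunctor k L).map δ).left :=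
  (GaloisDescent.gal_comp_map_left L δ σ).symm

/-- **The twisted morphism `F' ∘ (1 × Spec σ⁻¹) : N_L → J'^{σ⁻¹}`**, an `L`-morphism into the
conjugate abelian variety (Milne §6: "`σF`"). [cite: Milne1986JacobianVarieties, §6 Prop. 6.4 (proof)] -/
private def diffTwist (σ : L ≃ₐ[k] L) : (bcFunctor k L).obj N ⟶ (twistAV L σ⁻¹ 𝒜.J).X :=
  Over.homMk (pullback.lift (GaloisDescent.gal L N σ ≫ 𝒜.F.left) ((bcFunctor k L).obj N).hom (by
      rw [Category.assoc, Over.w 𝒜.F]; exact gal_comp_hom L σ))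
    (by exact pullback.lift_snd _ _ _)

/-- `(F' ∘ (1 × Spec σ⁻¹)) ≫ pr₁ = (1 × Spec σ⁻¹) ≫ F'`. [folklore] -/
private theorem diffTwist_left_comp_fst (σ : L ≃ₐ[k] L) :
    (diffTwist L 𝒜 σ).left ≫ pullback.fst 𝒜.J.X.hom (specAut L σ⁻¹) =
      GaloisDescent.gal L N σ ≫ 𝒜.F.left :=
  pullback.lift_fst _ _ _

/-- The twisted morphism is trivial along `δ_L` (the right-hand side is the constant morphism
`1 = toUnit ≫ e`, `Hom.one_def`). [folklore] -/
private theorem base_diffTwist (σ : L ≃ₐ[k] L) :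
    (bcFunctor k L).map δ ≫ diffTwist L 𝒜 σ = toUnit _ ≫ η[(twistAV L σ⁻¹ 𝒜.J).X] := by
  ext1
  apply pullback.hom_ext
  · rw [Over.comp_left, Category.assoc, diffTwist_left_comp_fst,
      reassoc_of% (map_left_comp_gal L σ), ← Over.comp_left, 𝒜.base, one_left,
      one_hom_twist_left_comp_fst]
    exact GaloisDescent.gal_snd_assoc L D σ _
  · exact (Over.w _).trans (Over.w _).symm

/-- **The homomorphism `u_σ : J' → J'^{σ⁻¹}`** through which `F' ∘ (1 × Spec σ⁻¹)` factors
(universal property over `L`). [cite: Milne1986JacobianVarieties, §6 Prop. 6.4 (proof) and Remark 6.5] -/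
private def descTwist (σ : L ≃ₐ[k] L) : 𝒜.J ⟶ twistAV L σ⁻¹ 𝒜.J :=
  𝒜.desc (diffTwist L 𝒜 σ) (base_diffTwist L 𝒜 σ)

/-- **The Galois automorphism `ρ σ = u_σ ≫ pr₁` of the scheme `J'`** (`σ⁻¹`-semilinear).
[cite: Milne1986JacobianVarieties, Remark 1.9 and §6 Prop. 6.4 (proof)] -/
private def galJ (σ : L ≃ₐ[k] L) : 𝒜.J.X.left ⟶ 𝒜.J.X.left := descLeft L σ⁻¹ (descTwist L 𝒜 σ)

/-- **`F'` is equivariant: `F' ≫ ρ σ = (1 × Spec σ⁻¹) ≫ F'`.**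
[cite: Milne1986JacobianVarieties, §6 ("σF = F")] -/
private theorem F_left_comp_galJ (σ : L ≃ₐ[k] L) :
    𝒜.F.left ≫ galJ L 𝒜 σ = GaloisDescent.gal L N σ ≫ 𝒜.F.left := by
  unfold galJ descLeft
  rw [← Over.comp_left_assoc, descTwist, 𝒜.fac, diffTwist_left_comp_fst]

/-- `ρ σ` covers `Spec σ⁻¹`. [folklore] -/
private theorem galJ_comp_hom (σ : L ≃ₐ[k] L) :
    galJ L 𝒜 σ ≫ 𝒜.J.X.hom = 𝒜.J.X.hom ≫ specAut L σ⁻¹ :=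
  descLeft_comp_hom L σ⁻¹ _

/-- `e ≫ ρ σ = Spec σ⁻¹ ≫ e`. [folklore] -/
private theorem one_left_comp_galJ (σ : L ≃ₐ[k] L) :
    (η[𝒜.J.X]).left ≫ galJ L 𝒜 σ = specAut L σ⁻¹ ≫ (η[𝒜.J.X]).left :=
  one_left_comp_descLeft L σ⁻¹ _

/-- `i ≫ ρ σ = ρ σ ≫ i`. [folklore] -/
private theorem inv_left_comp_galJ (σ : L ≃ₐ[k] L) :
    (ι[𝒜.J.X]).left ≫ galJ L 𝒜 σ = galJ L 𝒜 σ ≫ (ι[𝒜.J.X]).left :=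
  inv_left_comp_descLeft L σ⁻¹ _

/-- **Uniqueness**: a `σ⁻¹`-semilinear unit-preserving `s : J' → J'` with
`F' ≫ s = (1 × Spec σ⁻¹) ≫ F'` is `ρ σ` (uniqueness in the universal property).
[cite: Milne1986JacobianVarieties, §6 Remark 6.5] -/
private theorem eq_galJ (σ : L ≃ₐ[k] L) (s : 𝒜.J.X.left ⟶ 𝒜.J.X.left)
    (hs : s ≫ 𝒜.J.X.hom = 𝒜.J.X.hom ≫ specAut L σ⁻¹)
    (hone : (η[𝒜.J.X]).left ≫ s = specAut L σ⁻¹ ≫ (η[𝒜.J.X]).left)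
    (hF : 𝒜.F.left ≫ s = GaloisDescent.gal L N σ ≫ 𝒜.F.left) : s = galJ L 𝒜 σ := by
  have hv : twistHom L σ⁻¹ s hs hone = descTwist L 𝒜 σ := by
    refine 𝒜.uniq _ _ _ ?_
    ext1
    apply pullback.hom_ext
    · rw [Over.comp_left, Category.assoc, diffTwist_left_comp_fst, ← hF]
      congr 1
      exact descLeft_twistHom L σ⁻¹ s hs hone
    · exact (Over.w _).trans (Over.w _).symm
  rw [← descLeft_twistHom L σ⁻¹ s hs hone, hv]
  rfl

/-- `ρ 1 = 1`. [folklore] -/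
private theorem galJ_one : galJ L 𝒜 1 = 𝟙 _ := by
  refine (eq_galJ L 𝒜 1 (𝟙 _) ?_ ?_ ?_).symm
  · rw [inv_one, specAut_one, Category.id_comp, Category.comp_id]
  · rw [inv_one, specAut_one, Category.id_comp, Category.comp_id]
  · rw [GaloisDescent.gal_one, Category.id_comp, Category.comp_id]

/-- `ρ (στ) = ρ τ ≫ ρ σ` (the cocycle condition). [cite: Milne1986JacobianVarieties, Remark 1.9] -/
private theorem galJ_mul (σ τ : L ≃ₐ[k] L) : galJ L 𝒜 (σ * τ) = galJ L 𝒜 τ ≫ galJ L 𝒜 σ := by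
  refine (eq_galJ L 𝒜 (σ * τ) (galJ L 𝒜 τ ≫ galJ L 𝒜 σ) ?_ ?_ ?_).symm
  · rw [Category.assoc, galJ_comp_hom, reassoc_of% (galJ_comp_hom L 𝒜 τ), mul_inv_rev, specAut_mul]
  · rw [reassoc_of% (one_left_comp_galJ L 𝒜 τ), one_left_comp_galJ, mul_inv_rev, specAut_mul,
      Category.assoc]
  · rw [reassoc_of% (F_left_comp_galJ L 𝒜 τ), F_left_comp_galJ, GaloisDescent.gal_mul,
      Category.assoc]

/-- `ρ σ ≫ ρ σ⁻¹ = 1`. [folklore] -/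
private theorem galJ_comp_galJ_symm (σ : L ≃ₐ[k] L) : galJ L 𝒜 σ ≫ galJ L 𝒜 σ⁻¹ = 𝟙 _ := by
  rw [← galJ_mul, inv_mul_cancel, galJ_one]

/-- **The Galois action on the scheme `J'` over `Spec k`.** [cite: Milne1986JacobianVarieties, Remark 1.9] -/
private def galAction : Literature.AlgebraicGeometry.RelativeSpec.ActionOver (𝒜.J.X.hom ≫ bcSpec k L) (L ≃ₐ[k] L) where
  aut :=
    { toFun := fun σ => ⟨galJ L 𝒜 σ, galJ L 𝒜 σ⁻¹, galJ_comp_galJ_symm L 𝒜 σ, by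
        simpa only [inv_inv] using galJ_comp_galJ_symm L 𝒜 σ⁻¹⟩
      map_one' := by ext1; exact galJ_one L 𝒜
      map_mul' := fun σ τ => by ext1; exact galJ_mul L 𝒜 σ τ }
  aut_comp σ := by
    change galJ L 𝒜 σ ≫ 𝒜.J.X.hom ≫ bcSpec k L = _
    rw [reassoc_of% (galJ_comp_hom L 𝒜 σ), specAut_comp_bcSpec]

end Action

/-! ### Descent of the universal morphism to `k` -/

section Descent

variable {k : Type u} [Field k] (L : Type u) [Field L] [Algebra k L] {D N : SchemeOver k}
  {δ : D ⟶ N} (𝒜 : TrivDatum ((bcFunctor k L).map δ)) (J : AbelianVariety k)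
  (e : 𝒜.J ≅ J.baseChange L)

/-- The universal morphism over `L`, read in `J_L` through `e`: `F'_e = F' ≫ e : N_L → J_L`.
[folklore] -/
private def FL : (bcFunctor k L).obj N ⟶ (bcFunctor k L).obj J.X := 𝒜.F ≫ e.hom.hom.hom.hom

/-- The base change of a morphism trivial along `δ` is trivial along `δ_L` (the base-change functor
is monoidal: `Functor.map_one`). [folklore] -/
private theorem map_base {A : AbelianVariety k} (f : N ⟶ A.X) (hf : δ ≫ f = 1) :
    (bcFunctor k L).map δ ≫ (bcFunctor k L).map f = (1 : _ ⟶ (A.baseChange L).X) := by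
  rw [← Functor.map_comp, hf]
  exact Functor.map_one (bcFunctor k L)

/-- The factorisation over `L`, read in `J_L`: `e⁻¹ ≫ desc'(f_L) : J_L → A_L`. [folklore] -/
private def descL {A : AbelianVariety k} (f : N ⟶ A.X) (hf : δ ≫ f = 1) :
    J.baseChange L ⟶ A.baseChange L :=
  e.inv ≫ 𝒜.desc ((bcFunctor k L).map f) (map_base L f hf)

/-- **The Galois conjugates of a factorisation are again factorisations**: if `ψ : J_L → A_L`
satisfies `F_L ≫ ψ = f_L` for `k`-morphisms `F : N → J`, `f : N → A`, then so does `σ • ψ`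
(`F_L`, `f_L` commute with the Galois automorphisms, `GaloisDescent.gal_comp_map_left`; this is
"(since `F`, `φ` are defined over `k`)" of Milne's proof of Prop. 6.4, as in
`Jacobian.map_comp_galConjHom`). [cite: Milne1986JacobianVarieties, §6 Prop. 6.4 (proof)] -/
private theorem map_comp_galConjHom {A : AbelianVariety k} (F : N ⟶ J.X) (f : N ⟶ A.X)
    (σ : L ≃ₐ[k] L) (ψ : J.baseChange L ⟶ A.baseChange L)
    (hψ : (bcFunctor k L).map F ≫ ψ.hom.hom.hom = (bcFunctor k L).map f) :
    (bcFunctor k L).map F ≫ (galConjHom L σ J A ψ).hom.hom.hom = (bcFunctor k L).map f := by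
  apply Over.OverMorphism.ext
  have h1 : ((bcFunctor k L).map F).left ≫ AbelianVariety.Hom.toSchemeHom ψ =
      ((bcFunctor k L).map f).left :=
    congrArg CommaMorphism.left hψ
  change ((bcFunctor k L).map F).left ≫ AbelianVariety.Hom.toSchemeHom (galConjHom L σ J A ψ) =
    ((bcFunctor k L).map f).left
  rw [toSchemeHom_galConjHom, AbelianVariety.gal_eq_gal, AbelianVariety.gal_eq_gal,
    ← GaloisDescent.gal_comp_map_left_assoc, reassoc_of% h1, ← GaloisDescent.gal_comp_map_left,
    GaloisDescent.gal_symm_comp_gal_assoc]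

variable (he : ∀ σ : L ≃ₐ[k] L, ((galAction L 𝒜).aut σ).hom ≫ AbelianVariety.Hom.toSchemeHom e.hom =
    AbelianVariety.Hom.toSchemeHom e.hom ≫ J.gal L σ)

include he in
/-- **`F'_e` commutes with the Galois automorphisms** ("`σF = F`"). [cite: Milne1986JacobianVarieties, §6] -/
private theorem gal_comp_FL_left (σ : L ≃ₐ[k] L) :
    GaloisDescent.gal L N σ ≫ (FL L 𝒜 J e).left = (FL L 𝒜 J e).left ≫ J.gal L σ := by
  rw [FL, Over.comp_left, Category.assoc, ← reassoc_of% (F_left_comp_galJ L 𝒜 σ)]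
  congr 1
  exact he σ

variable [FiniteDimensional k L] [IsGalois k L] [IsReduced (GaloisDescent.bc L N)]
  [LocallyOfFiniteType N.hom]

include he

/-- **The descended morphism `F : N → J` over `k`** (`GaloisDescent.descentOver`; "`F` is defined
over `k`"). [cite: Milne1986JacobianVarieties, §6 (before Prop. 6.4)] [cite: GortzWedhorn2020, Thm. 14.72 (1)] -/
private def F₀ : N ⟶ J.X :=
  GaloisDescent.descentOver L (X := N) (Y := J.X) (FL L 𝒜 J e) (gal_comp_FL_left L 𝒜 J e he)

/-- `(F₀)_L = F'_e`. [folklore] -/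
private theorem bcFunctor_map_F₀ : (bcFunctor k L).map (F₀ L 𝒜 J e he) = FL L 𝒜 J e :=
  GaloisDescent.bcFunctor_map_descentOver L _ _

/-- `δ ≫ F₀ = 1` (checked after the faithful base change: `δ_L ≫ F' ≫ e = 1 ≫ e = 1`). [folklore] -/
private theorem base_F₀ : δ ≫ F₀ L 𝒜 J e he = 1 := by
  refine AbelianVariety.bcFunctor_map_injective L ?_
  rw [Functor.map_comp, bcFunctor_map_F₀, FL, ← Category.assoc, 𝒜.base, MonObj.one_comp]
  exact (Functor.map_one (bcFunctor k L)).symm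

/-- `(F₀)_L ≫ descL f = f_L`. [folklore] -/
private theorem facL {A : AbelianVariety k} (f : N ⟶ A.X) (hf : δ ≫ f = 1) :
    (bcFunctor k L).map (F₀ L 𝒜 J e he) ≫ (descL L 𝒜 J e f hf).hom.hom.hom =
      (bcFunctor k L).map f := by
  rw [bcFunctor_map_F₀, FL, descL, Category.assoc]
  change 𝒜.F ≫ (e.hom ≫ e.inv ≫ 𝒜.desc _ _).hom.hom.hom = _
  rw [e.hom_inv_id_assoc]
  exact 𝒜.fac _ _

/-- Uniqueness of the factorisation over `L`. [folklore] -/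
private theorem uniqL {A : AbelianVariety k} (f : N ⟶ A.X) (hf : δ ≫ f = 1)
    (ψ : J.baseChange L ⟶ A.baseChange L)
    (hψ : (bcFunctor k L).map (F₀ L 𝒜 J e he) ≫ ψ.hom.hom.hom = (bcFunctor k L).map f) :
    ψ = descL L 𝒜 J e f hf := by
  rw [descL, Iso.eq_inv_comp]
  refine 𝒜.uniq _ _ (e.hom ≫ ψ) ?_
  change 𝒜.F ≫ (e.hom.hom.hom.hom ≫ ψ.hom.hom.hom) = _
  rw [bcFunctor_map_F₀, FL, Category.assoc] at hψ
  exact hψ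

/-- **The descended universal morphism** (Milne, Prop. 6.4, first paragraph of the proof: "the
uniqueness implies that `σψ = ψ` for all `σ` in `Gal(k'/k)`, and so `ψ` is defined over `k`";
`F ≫ ψ₀ = f` and the uniqueness of `ψ₀` hold because they hold after the faithful base change to `L`).
[cite: Milne1986JacobianVarieties, §6 Prop. 6.4 (proof, first paragraph)] -/
private def descend : TrivDatum δ where
  J := J
  F := F₀ L 𝒜 J e he
  base := base_F₀ L 𝒜 J e he
  desc {A} f hf :=
    galoisDescent L J A (descL L 𝒜 J e f hf) (fun σ ↦ gal_comp_toSchemeHom_of_galConjHom_eq L σ J A _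
      (uniqL L 𝒜 J e he f hf _
        (map_comp_galConjHom L J (F₀ L 𝒜 J e he) f σ (descL L 𝒜 J e f hf) (facL L 𝒜 J e he f hf))))
  fac {A} f hf := by
    refine AbelianVariety.bcFunctor_map_injective L ?_
    rw [Functor.map_comp, ← AbelianVariety.Hom.baseChange_hom_hom_hom, baseChange_galoisDescent]
    exact facL L 𝒜 J e he f hf
  uniq {A} f hf ψ hψ := by
    refine AbelianVariety.eq_of_baseChange_eq L J A ?_
    rw [baseChange_galoisDescent]
    refine uniqL L 𝒜 J e he f hf _ ?_
    rw [AbelianVariety.Hom.baseChange_hom_hom_hom, ← Functor.map_comp, hψ]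

end Descent

/-! ### Liu's Proposition, descent step -/

variable {k : Type u} [Field k] (L : Type u) [Field L] [Algebra k L] [FiniteDimensional k L]
  [IsGalois k L] {X : SchemeOver k}

/-- **[Liu2021, §2.1, proof of the Proposition, last step] Galois descent of the Albanese datum.**
Let `L / k` be a finite Galois extension, `N` a `∇X` of the `k`-scheme `X` (Def. 2.1 (1)) with `N ×_k L`
reduced and `N → Spec k` locally of finite type, and `a` an Albanese datum (Def. 2.3) of
`X_L = X ×_k L` together with an isomorphism `e : N ×_k L ≅ ∇(X_L)` (the `∇` of `a`) under which the
base-changed diagonal `(ΔX)_L` is the diagonal `Δ(X_L)` — Liu's «as `(∇X)_{k'} ≃ ∇_{k'}X'`».  Then `X`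
has an Albanese datum over `k`, with `∇X := N`: «the statement for `X` then follows by Galois descent»
(l. 1199–1200).  Proof: Milne's descent argument (*Jacobian Varieties* Rem. 1.9, proof of Prop. 6.4)
— the Galois group acts semilinearly on `Alb_{X_L}` through the universal property, the action descends
the abelian variety (`GaloisDescentAbelianVariety.exists_iso_baseChange`), the Albanese morphism
(`GaloisDescent.descentOver`) and the universal property (`AbelianVariety.galoisDescent`).  Ours.
[cite: Liu2021, §2.1 Proposition (FJcycle.tex l. 1190–1192) with proof (l. 1194–1200), Def. 2.3 (l. 1202–1208)]
[cite: Milne1986JacobianVarieties, Remark 1.9 and §6 Prop. 6.4 (proof, first paragraph)]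
[cite: GortzWedhorn2020, Thm. 14.72 (1), Thm. 14.83 and Cor. 14.85] -/
theorem nonempty_of_albanese_baseChange (N : Nabla X) [IsReduced (GaloisDescent.bc L N.N)]
    [LocallyOfFiniteType N.N.hom] (a : Albanese ((bcFunctor k L).obj X))
    (e : (bcFunctor k L).obj N.N ≅ a.nabla.N) (he : (bcFunctor k L).map N.diag ≫ e.hom = a.nabla.diag) :
    Nonempty (Albanese X) := by
  let 𝒜 : TrivDatum ((bcFunctor k L).map N.diag) := (TrivDatum.ofAlbanese a).transport e he
  have hρ : ∀ σ : L ≃ₐ[k] L,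
      ((galAction L 𝒜).aut σ).hom ≫ 𝒜.J.X.hom = 𝒜.J.X.hom ≫ specAut L σ⁻¹ :=
    fun σ => galJ_comp_hom L 𝒜 σ
  obtain ⟨J, e', he'⟩ := GaloisDescentAbelianVariety.exists_iso_baseChange L 𝒜.J (galAction L 𝒜) hρ
    (fun σ => map_comp_mul_left_descLeft L σ⁻¹ (descTwist L 𝒜 σ))
    (fun σ => one_left_comp_galJ L 𝒜 σ) (fun σ => inv_left_comp_galJ L 𝒜 σ)
  exact ⟨ofTrivDatum N (descend L 𝒜 J e' he')⟩

/-- **Galois descent of the Albanese datum, WITH the comparison isomorphism** (the comparison half of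
Milne's descent, *Jacobian Varieties* Rem. 1.9: the descended variety becomes isomorphic to the given
one over `L`).  Under the hypotheses of `nonempty_of_albanese_baseChange` — `L / k` finite Galois, `N` a
`∇X` with `N ×_k L` reduced and `N` locally of finite type over `k`, `a` an Albanese datum of `X_L`
with `e : N ×_k L ≅ ∇(X_L)` matching the diagonals — there is an Albanese datum `a₀` of `X` over `k`
(Def. 2.3) with `∇X := N` whose Albanese variety base-changes to that of `a`:
`a.Alb ≅ a₀.Alb ×_k L` as abelian varieties over `L` («`(Alb_X)_{k'} ≅ Alb_{X'}`» for the CONSTRUCTED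
`Alb_X`, proof of the Proposition l. 1194–1200).  Same construction as `nonempty_of_albanese_baseChange`,
keeping the isomorphism of `GaloisDescentAbelianVariety.exists_iso_baseChange`.  Ours.
[cite: Liu2021, §2.1 Proposition (FJcycle.tex l. 1190–1192) with proof (l. 1194–1200), Def. 2.3 (l. 1202–1208)]
[cite: Milne1986JacobianVarieties, Remark 1.9 and §6 Prop. 6.4 (proof, first paragraph)] -/
theorem exists_iso_baseChange_of_albanese_baseChange (N : Nabla X) [IsReduced (GaloisDescent.bc L N.N)]
    [LocallyOfFiniteType N.N.hom] (a : Albanese ((bcFunctor k L).obj X))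
    (e : (bcFunctor k L).obj N.N ≅ a.nabla.N) (he : (bcFunctor k L).map N.diag ≫ e.hom = a.nabla.diag) :
    ∃ a₀ : Albanese X, a₀.nabla = N ∧ Nonempty (a.Alb ≅ a₀.Alb.baseChange L) := by
  let 𝒜 : TrivDatum ((bcFunctor k L).map N.diag) := (TrivDatum.ofAlbanese a).transport e he
  have hρ : ∀ σ : L ≃ₐ[k] L,
      ((galAction L 𝒜).aut σ).hom ≫ 𝒜.J.X.hom = 𝒜.J.X.hom ≫ specAut L σ⁻¹ :=
    fun σ => galJ_comp_hom L 𝒜 σ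
  obtain ⟨J, e', he'⟩ := GaloisDescentAbelianVariety.exists_iso_baseChange L 𝒜.J (galAction L 𝒜) hρ
    (fun σ => map_comp_mul_left_descLeft L σ⁻¹ (descTwist L 𝒜 σ))
    (fun σ => one_left_comp_galJ L 𝒜 σ) (fun σ => inv_left_comp_galJ L 𝒜 σ)
  exact ⟨ofTrivDatum N (descend L 𝒜 J e' he'), rfl, ⟨e'⟩⟩

/-- **Galois descent of the Albanese datum, WITH the comparison isomorphism AND its compatibility with
the two Albanese morphisms** (appended 2026-08-28, cell hodgecm-mathlib, III-0 «(G)-road» piece G2: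
the α-compatible finite-Galois Albanese fan; lead A-p18).  Same hypotheses and SAME construction as
`exists_iso_baseChange_of_albanese_baseChange`; exposed in addition: the carrier identification
`n : (∇X := N) ×_k L ≅ ∇(X_L)` (it is the given `e`, matching the diagonals) and the law
**`n ≫ α ≫ i = (α₀)_L`** — the descended Albanese morphism `α₀ : N → Alb₀` base-changes, through the
comparison isomorphism `i : Alb ≅ Alb₀ ×_k L` of `GaloisDescentAbelianVariety.exists_iso_baseChange`,
to the given `α : ∇(X_L) → Alb` read on `N ×_k L` (this is `GaloisDescent.bcFunctor_map_descentOver`: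
the descended morphism IS the given one after base change, Milne *Jacobian Varieties* §6 proof of
Prop. 6.4 «`ψ` is defined over `k`»).  Ours.
[cite: Liu2021, §2.1 Proposition (FJcycle.tex l. 1190–1192) with proof (l. 1194–1200), Def. 2.3 (l. 1202–1208)]
[cite: Milne1986JacobianVarieties, Remark 1.9 and §6 Prop. 6.4 (proof, first paragraph)] -/
theorem exists_iso_baseChange_of_albanese_baseChange_compat (N : Nabla X)
    [IsReduced (GaloisDescent.bc L N.N)] [LocallyOfFiniteType N.N.hom] (a : Albanese ((bcFunctor k L).obj X))
    (e : (bcFunctor k L).obj N.N ≅ a.nabla.N) (he : (bcFunctor k L).map N.diag ≫ e.hom = a.nabla.diag) :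
    ∃ (a₀ : Albanese X) (n : (bcFunctor k L).obj a₀.nabla.N ≅ a.nabla.N) (i : a.Alb ≅ a₀.Alb.baseChange L),
      a₀.nabla = N ∧ (bcFunctor k L).map a₀.nabla.diag ≫ n.hom = a.nabla.diag ∧
        n.hom ≫ a.α ≫ i.hom.hom.hom.hom = (bcFunctor k L).map a₀.α := by
  let 𝒜 : TrivDatum ((bcFunctor k L).map N.diag) := (TrivDatum.ofAlbanese a).transport e he
  have hρ : ∀ σ : L ≃ₐ[k] L,
      ((galAction L 𝒜).aut σ).hom ≫ 𝒜.J.X.hom = 𝒜.J.X.hom ≫ specAut L σ⁻¹ :=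
    fun σ => galJ_comp_hom L 𝒜 σ
  obtain ⟨J, e', he'⟩ := GaloisDescentAbelianVariety.exists_iso_baseChange L 𝒜.J (galAction L 𝒜) hρ
    (fun σ => map_comp_mul_left_descLeft L σ⁻¹ (descTwist L 𝒜 σ))
    (fun σ => one_left_comp_galJ L 𝒜 σ) (fun σ => inv_left_comp_galJ L 𝒜 σ)
  refine ⟨ofTrivDatum N (descend L 𝒜 J e' he'), e, e', rfl, he, ?_⟩
  change (e.hom ≫ a.α) ≫ e'.hom.hom.hom.hom = (bcFunctor k L).map (F₀ L 𝒜 J e' he')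
  rw [bcFunctor_map_F₀]
  rfl

/-- **Galois descent of the Albanese datum with ALL its compatibilities** (appended 2026-08-28, III-0
«(G)-road» piece G2′ — the input shape of the α-compatible finite-Galois fan G4): as
`exists_iso_baseChange_of_albanese_baseChange_compat`, for a carrier identification
`e : N ×_k L ≅ ∇(X_L)` that moreover lies OVER `X_L × X_L` (`hei`, the first conjunct of
`Nabla.exists_of_nabla_baseChange_incl`), the descended datum `a₀` (with `∇X := N`) comes with
`n : (∇X) ×_k L ≅ ∇(X_L)` over `X_L × X_L` and matching the diagonals, the comparison isomorphism
`i : Alb ≅ Alb₀ ×_k L`, and the law `n ≫ α ≫ i = (α₀)_L` in BOTH orientations.  Same construction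
(`n := e`).  Ours. [cite: Liu2021, §2.1 Proposition (FJcycle.tex l. 1190–1192) with proof (l. 1194–1200), Def. 2.3 (l. 1202–1208)]
[cite: Milne1986JacobianVarieties, Remark 1.9 and §6 Prop. 6.4 (proof, first paragraph)] -/
theorem exists_iso_baseChange_of_albanese_baseChange_compat_incl (N : Nabla X)
    [IsReduced (GaloisDescent.bc L N.N)] [LocallyOfFiniteType N.N.hom] (a : Albanese ((bcFunctor k L).obj X))
    (e : (bcFunctor k L).obj N.N ≅ a.nabla.N) (he : (bcFunctor k L).map N.diag ≫ e.hom = a.nabla.diag)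
    (hei : e.hom ≫ a.nabla.incl ≫ Functor.LaxMonoidal.μ (bcFunctor k L) X X = (bcFunctor k L).map N.incl) :
    ∃ (a₀ : Albanese X) (n : (bcFunctor k L).obj a₀.nabla.N ≅ a.nabla.N) (i : a.Alb ≅ a₀.Alb.baseChange L),
      a₀.nabla = N ∧ (bcFunctor k L).map a₀.nabla.diag ≫ n.hom = a.nabla.diag ∧
        n.hom ≫ a.nabla.incl ≫ Functor.LaxMonoidal.μ (bcFunctor k L) X X = (bcFunctor k L).map a₀.nabla.incl ∧
        n.hom ≫ a.α ≫ i.hom.hom.hom.hom = (bcFunctor k L).map a₀.α ∧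
        (bcFunctor k L).map a₀.α ≫ i.inv.hom.hom.hom = n.hom ≫ a.α := by
  let 𝒜 : TrivDatum ((bcFunctor k L).map N.diag) := (TrivDatum.ofAlbanese a).transport e he
  have hρ : ∀ σ : L ≃ₐ[k] L,
      ((galAction L 𝒜).aut σ).hom ≫ 𝒜.J.X.hom = 𝒜.J.X.hom ≫ specAut L σ⁻¹ :=
    fun σ => galJ_comp_hom L 𝒜 σ
  obtain ⟨J, e', he'⟩ := GaloisDescentAbelianVariety.exists_iso_baseChange L 𝒜.J (galAction L 𝒜) hρ
    (fun σ => map_comp_mul_left_descLeft L σ⁻¹ (descTwist L 𝒜 σ))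
    (fun σ => one_left_comp_galJ L 𝒜 σ) (fun σ => inv_left_comp_galJ L 𝒜 σ)
  have hα : (e.hom ≫ a.α) ≫ e'.hom.hom.hom.hom = (bcFunctor k L).map (F₀ L 𝒜 J e' he') := by
    rw [bcFunctor_map_F₀]
    rfl
  refine ⟨ofTrivDatum N (descend L 𝒜 J e' he'), e, e', rfl, he, hei, ?_, ?_⟩
  · change (e.hom ≫ a.α) ≫ e'.hom.hom.hom.hom = (bcFunctor k L).map (F₀ L 𝒜 J e' he')
    exact hα
  · change (bcFunctor k L).map (F₀ L 𝒜 J e' he') ≫ e'.inv.hom.hom.hom = e.hom ≫ a.α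
    have hid : e'.hom.hom.hom.hom ≫ e'.inv.hom.hom.hom = 𝟙 _ := by
      change (e'.hom ≫ e'.inv).hom.hom.hom = _
      rw [e'.hom_inv_id]
      rfl
    rw [← hα, Category.assoc, hid]
    exact Category.comp_id (e.hom ≫ a.α)

end Albanese

end Literature.NumberTheory.Automorphic.Liu2021.AppendixC

end
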